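import Summits.MatrixMultiplication.MatrixMultiplication.Theses.ProbeRankScaling
import Summits.MatrixMultiplication.MatrixMultiplication.Theorems.ProbeRankScalingAggregationSaturationToolkit
import Summits.MatrixMultiplication.MatrixMultiplication.Theorems.ProbeRankScalingAggregationSaturationPan

/-!
# ProbeRankScaling / AggregationSaturation (stmt-MatrixMultiplication-7540)

Support item `AggregationSaturation` of route `ProbeRankScaling` (NEGATIVE KNOWLEDGE for the
probe-rank filtration): at every constant probe rank `2^k` the one-leg law `R_ρ(n) ≥ n³/ρ` is
asymptotically tight —

  `∀ k, ∀ ε > 0, ∃ n₀, ∀ n ≥ n₀`, there is a decomposition `⟨n,n,n⟩ = ∑_{l<r} w_l ⊗ u_l ⊗ v_l`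
  over `ℂ` with all probe ranks `≤ 2^k` and `r ≤ (1+ε) n³ / 2^k`.

Proof (induction on `k`, the statement itself being the induction hypothesis).
* `k = 0`: the standard algorithm (`exists_decomp_schoolbook`): `n³` terms, probe ranks `≤ 1`.
* `k → k+1`: put `η = min 1 (ε/31)`, `s = ⌈3/η⌉₊` (so `1 + 3/s ≤ 1 + η`), and take the
  threshold `q₀` of the induction hypothesis at `η`. For `n ≥ max ⌈2s/η⌉₊ (2sq₀)` let
  `q = n/(2s) + 1 ≥ q₀`, so `n ≤ 2sq ≤ n + 2s ≤ (1+η)n`. Pan's two-fold aggregation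
  (`exists_decomp_pan`: `⟨2s⟩` with `4(s³+3s²) = 4s³(1+3/s)` terms, probe ranks `≤ 2`)
  Kronecker the hypothesis' decomposition of `⟨q⟩` (`≤ (1+η)q³/2^k` terms, ranks `≤ 2^k`) is a
  decomposition of `⟨2sq⟩` with probe ranks `≤ 2·2^k` (`exists_decomp_mul`), which restricts to
  `⟨n⟩` (`exists_decomp_of_le`); its number of terms is
  `≤ 4s³(1+η)·(1+η)q³/2^k = (1+η)²(2sq)³/2^(k+1) ≤ (1+η)⁵ n³/2^(k+1) ≤ (1+31η) n³/2^(k+1)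
   ≤ (1+ε) n³/2^(k+1)`.

References: V. Ya. Pan, *How to Multiply Matrices Faster*, LNCS 179 (1984), §4;
M. Bläser, *Fast Matrix Multiplication*, Theory of Computing Graduate Surveys 5 (2013), §5.
-/

-- `Summit.<Summit>.<Problem>` is the tree's mandated summit-side namespace; for this
-- single-conjunct summit the two coincide, so the file silences `dupNamespace`.
set_option linter.dupNamespace false

noncomputable section

open scoped BigOperators
open Function Matrix

namespace Summit.MatrixMultiplication.MatrixMultiplication.Theorems

open Literature.Computability.AlgebraicComplexity ProbeRankScalingAggregationSaturation

/-- Elementary bound `(1+η)⁵ ≤ 1 + 31η` on `[0,1]` (chord of the convex function). [folklore] -/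
theorem ProbeRankScalingAggregationSaturation.one_add_pow_five_le {η : ℝ} (h0 : 0 ≤ η)
    (h1 : η ≤ 1) : (1 + η) ^ 5 ≤ 1 + 31 * η := by
  have h2 : η ^ 2 ≤ η := by nlinarith
  have h3 : η ^ 3 ≤ η := by nlinarith
  have h4 : η ^ 4 ≤ η := by nlinarith
  have h5 : η ^ 5 ≤ η := by nlinarith
  nlinarith [h2, h3, h4, h5]

/-- **Support item `AggregationSaturation` of route ProbeRankScaling**
(stmt-MatrixMultiplication-7540), exact route decl: for every `k` and `ε > 0`, for all large
`n` the matrix multiplication tensor `⟨n,n,n⟩` over `ℂ` has a decomposition with all probe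
ranks `≤ 2^k` and at most `(1+ε) n³/2^k` terms (Kronecker powers of Pan's two-fold aggregation
with growing block size, restricted to `⟨n⟩`), so at every constant probe rank `2^k` the
one-leg law is asymptotically tight. [cite: Pan1984, (4.1)-(4.3)] -/
theorem aggregationSaturation_proof :
    Summit.MatrixMultiplication.MatrixMultiplication.Theses.ProbeRankScaling.AggregationSaturation :=
    by
  unfold
    Summit.MatrixMultiplication.MatrixMultiplication.Theses.ProbeRankScaling.AggregationSaturation
  intro k
  induction k with
  | zero =>
    intro ε hε
    refine ⟨0, fun n _ => ?_⟩
    obtain ⟨w, u, v, h, hr⟩ := exists_decomp_schoolbook n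
    refine ⟨n ^ 3, w, u, v, h, fun l => ?_, ?_⟩
    · rw [pow_zero]
      exact hr l
    · rw [pow_zero, div_one]
      push_cast
      have := mul_nonneg hε.le (pow_nonneg (Nat.cast_nonneg n : (0 : ℝ) ≤ n) 3)
      linarith
  | succ k ih =>
    intro ε hε
    -- the slack `η` and the Pan block size `s`
    set η : ℝ := min 1 (ε / 31) with hη
    have hη0 : 0 < η := lt_min one_pos (by positivity)
    have hη1 : η ≤ 1 := min_le_left _ _
    have hηε : 31 * η ≤ ε := by
      have := min_le_right 1 (ε / 31)
      linarith
    obtain ⟨q₀, hq₀⟩ := ih η hη0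
    obtain ⟨s, hs3, hs1⟩ : ∃ s : ℕ, 3 / η ≤ s ∧ 1 ≤ s :=
      ⟨⌈3 / η⌉₊, Nat.le_ceil _, Nat.one_le_iff_ne_zero.2 (Nat.ceil_pos.2 (by positivity)).ne'⟩
    obtain ⟨wp, up, vp, hp, hpr⟩ := exists_decomp_pan s
    refine ⟨max ⌈2 * (s : ℝ) / η⌉₊ (2 * s * q₀), fun n hn => ?_⟩
    have hn1 : 2 * (s : ℝ) / η ≤ n := (Nat.ceil_le.1 (le_of_max_le_left hn))
    have hn2 : 2 * s * q₀ ≤ n := le_of_max_le_right hn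
    have h2s : 0 < 2 * s := by omega
    -- the inner size `q`
    set q : ℕ := n / (2 * s) + 1 with hq
    have hq₀q : q₀ ≤ q := by
      have : q₀ ≤ n / (2 * s) := (Nat.le_div_iff_mul_le h2s).2 (by
        calc q₀ * (2 * s) = 2 * s * q₀ := by ring
          _ ≤ n := hn2)
      omega
    have hle : n ≤ 2 * s * q := (Nat.lt_mul_div_succ n h2s).le
    have hle' : 2 * s * q ≤ n + 2 * s := by
      have := Nat.mul_div_le n (2 * s)
      simp only [hq, mul_add, mul_one]
      omega
    obtain ⟨r₁, w₁, u₁, v₁, h₁, hr₁, hbound₁⟩ := hq₀ q hq₀q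
    obtain ⟨w₂, u₂, v₂, h₂, hr₂⟩ := exists_decomp_mul hp h₁ hpr hr₁
    obtain ⟨w₃, u₃, v₃, h₃, hr₃⟩ := exists_decomp_of_le hle h₂ hr₂
    refine ⟨4 * (s ^ 3 + 3 * s ^ 2) * r₁, w₃, u₃, v₃, h₃, fun l => ?_, ?_⟩
    · rw [pow_succ']
      exact hr₃ l
    · -- the count
      have hS : (3 : ℝ) ≤ η * s := by
        have := (div_le_iff₀ hη0).1 hs3
        linarith
      have hN : 2 * (s : ℝ) * q ≤ (1 + η) * n := by
        have h1 : (2 * s * q : ℝ) ≤ n + 2 * s := by exact_mod_cast hle'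
        have h2 : 2 * (s : ℝ) ≤ n * η := (div_le_iff₀ hη0).1 hn1
        linarith
      have hS0 : (0 : ℝ) ≤ s := Nat.cast_nonneg s
      have hQ0 : (0 : ℝ) ≤ q := Nat.cast_nonneg q
      have hR0 : (0 : ℝ) ≤ r₁ := Nat.cast_nonneg r₁
      have h31 := ProbeRankScalingAggregationSaturation.one_add_pow_five_le hη0.le hη1
      push_cast
      calc (4 * ((s : ℝ) ^ 3 + 3 * (s : ℝ) ^ 2) * r₁)
          ≤ 4 * (s : ℝ) ^ 3 * (1 + η) * r₁ := by
            apply mul_le_mul_of_nonneg_right _ hR0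
            nlinarith [mul_nonneg hS0 hS0]
        _ ≤ 4 * (s : ℝ) ^ 3 * (1 + η) * ((1 + η) * (q : ℝ) ^ 3 / 2 ^ k) := by
            apply mul_le_mul_of_nonneg_left hbound₁
            positivity
        _ = (1 + η) ^ 2 * (2 * (s : ℝ) * q) ^ 3 / (2 * 2 ^ k) := by ring
        _ ≤ (1 + η) ^ 2 * ((1 + η) * n) ^ 3 / (2 * 2 ^ k) := by gcongr
        _ = (1 + η) ^ 5 * (n : ℝ) ^ 3 / 2 ^ (k + 1) := by rw [pow_succ]; ring
        _ ≤ (1 + 31 * η) * (n : ℝ) ^ 3 / 2 ^ (k + 1) := by gcongr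
        _ ≤ (1 + ε) * (n : ℝ) ^ 3 / 2 ^ (k + 1) := by gcongr

end Summit.MatrixMultiplication.MatrixMultiplication.Theorems

end
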